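import Mathlib
import HarnessLib
import HarnessLib.Audit
import Summits.KontsevichZagierPeriods.Statement
import Literature.Barriers.Schanuel.EFunctionValuesAtAlgebraicPoints
import Literature.NumberTheory.Transcendental.KZExpCalculus
import HarnessLib.Audit.Status.Attr

/-!
Route: LiftingCriteria

CLOSED (exhausted) 2026-08-17T18:21:27Z by planner-rbadge-KontsevichZagierPeriods-Lifting-78fa98cf-g3-0 — reason: exhausted — note: route-repair rbadge g3 (tribunal-failed:summit-strength, round 0, retarget null): retire. Census (evidence CLOSE-CENSUS.md on the route item): TRIED — André–Beukers lift transplanted to the G-side at the radius ϖ=1: no engine in print/tree beyond dimension one (André VII 5.2 / Beukers 2006 act at 0<. The file is kept as the record of this route; refuted decls are indexed as negative knowledge (`ledger negatives`).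

# Route LiftingCriteria — lift numerical period relations to functional ones in the dilation pencil,
transfer by Ayoub

Realises card abp-lifting (lifting criteria — Beukers/André/ABP — as the numbers-to-functions
engine). Put every relation into ONE canonical
pencil, the DILATION pencil at the cube vertex: for g Nash near [0,1]^n let v_g(ϖ) := ∫_{[0,1]^n}
g(ϖz)dz, a G-function with v_g(1) the period,
v_g(0) = g(0) algebraic, and g(ϖz) ∈ Ayoub's polynomial-coefficient algebra O†_alg. X :=
CubeNashNormalForm ∧ DilationTransfer ∧ DilationLiftAtOne:
(normal form) [r] − [r'] ≡ Σ ε_i [∫_cube g_i] with g_i Nash; (lift at 1 — the bet) w := m₀ + Σ m_i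
v_{g_i}, w(1) = 0 ⇒ w = (ϖ−1)(μ₀ + Σ μ_j v_{G_j})
in the enlarged ℝ_alg[ϖ]-module of Nash dilation functions; (transfer) such a functional relation
specialised at rational ϖ₀ ∈ (0,1] is a KZ
relation (Ayoub revisited Thm 1.7 + cube calibration). Unconditional rung: VertexLocalLift
(Andre1989 VII 5.2 at ξ = 1/b, K = ℚ) + VertexGlue ⇒
VertexKernel = Conjecture 1 (kernel form) for [1] and b^n ∫_{[0,1/b]^n} p_i/q_i, b ≥ b₀.
Lean: `CubeNashNormalForm ∧ DilationTransfer ∧ DilationLiftAtOne`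

## Assembly
Pure bookkeeping over the KZ calculus: r, r' rational with equal value ⇒ (CubeNashNormalForm) [r] −
[r'] ≡ Σ ε_i [s_i] with s_i cube-Nash;
soundness (Literature.NumberTheory.Transcendental.KZ.relations_le_ker_eval_holds, proved) gives Σ
ε_i v_{g_i}(1) = 0 (v_{g_i}(1) = value s_i);
DilationLiftAtOne with m = ε, m₀ = 0 gives the lift at 1; DilationTransfer at ϖ₀ = 1 (reps s_i, any
unit rep u of dimension 0) gives
Σ ε_i [s_i] ∈ relations, hence [r] − [r'] ∈ relations = KZ.Equivalent r r', i.e.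
KontsevichZagierPeriods (KontsevichZagierPeriods_iff).

Rationale: WHY THIS LINE. The only mechanism that ever turned numerical linear relations among special values
into functional ones wholesale is a lifting criterion
(auxiliary function + zero estimate): Beukers2006 for E-values, and in characteristic p the ABP
criterion (AndersonBrownawellPapanikolas2004) behind
Papanikolas2007 / ChangYu2007 "all relations are the functional ones" — a completeness theorem of
KZ's shape. For periods the functions are
G-functions, where lifting is a theorem only locally (Bombieri1981, Chudnovsky1984, Andre1989 VII
Thm 5.2, FischlerRivoal2014, FischlerRivoal2020).
Imported: transcendence of G- /E-values (numbers → functions) and Ayoub's relative KZ theorem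
AyoubRelKZRevisited Thm 1.7 (functions → algebraic
Stokes data, tree fact Literature.NumberTheory.Transcendental.AyoubRel.ayoub_relativeKZ_revisited).
The route's own device, absent from the six
prior routes and from route AyoubSpecialisation's engine-less Lifting crux 0362, is the dilation
pencil: at ξ = 1/b with ℚ-rational integrands the
archimedean place is the only small place, so André's Hasse principle applies to a single real
identity, and g(ϖz) has polynomial ϖ-coefficients,
so Ayoub's algebraic theorem applies to the lifted identity; the negatives index is empty and
NoriTransferRefutations is respected (pointwise
ℤ-combinations, no additive map from a ℚ-module).

RANKED CRUXES. #2 DilationLiftAtOne (crux) — (card G-Lift, made honest) for Nash cube functions g_i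
(any dimensions), integers m_i, m₀ with m₀ + Σ m_i ∫_cube g_i = 0, the G-function w(ϖ) = m₀ + Σ m_i
v_{g_i}(ϖ) factors as (ϖ − 1)·(μ₀(ϖ) + Σ_j μ_j(ϖ) v_{G_j}(ϖ)) on [0,1] for finitely many further
Nash cube functions G_j and polynomials μ with real-algebraic coefficients — the Beukers/ABP-shaped
statement "ev₁ is injective on D/(ϖ−1)D" for the dilation module D. [difficulty: open-problem] (why
it might fail: GPC-strength and NOT implied by KZ: at a special fibre (CM test: K(k) = K'(k), k² =
1/2, written as cube integrals) the difference quotient w/(ϖ−1) may lie outside the opaque module D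
(D(n=1) = {v : (ϖv)′ Nash}; closed under products only).) [Beukers2006,
AndersonBrownawellPapanikolas2004, Papanikolas2007, Andre1989, Fresan2024]
#3 DilationTransfer (crux) — (card Geo→Moves / RelativeTransfer, engine named) a functional relation
w = (ϖ − ϖ₀)(μ₀ + Σ μ_j v_{G_j}) on [0,1] among Nash dilation functions, specialised at a rational
ϖ₀ ∈ (0,1], is a KZ relation: m₀·[1] + Σ m_i·[∫_cube g_i(ϖ₀ z)dz] ∈ KZ.relations. Engine: the
integrand F(z,ϖ) = m₀ + Σ m_i g_i(ϖz) − (ϖ−ϖ₀)(…) lies in Ayoub's t-free O†_alg with ∫F = 0, so Thm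
1.7 writes F = Σ relA_i(H_i) with H_i ALGEBRAIC; specialise at ϖ₀ and use the cube calibration
(AyoubSpecialisation item 0543,
Summit.KontsevichZagierPeriods.KontsevichZagierPeriods.Theses.AyoubSpecialisation.AyoubRelACubeCalibration)
— algebraic primitives are legal Newton–Leibniz data. [difficulty: L] (why it might fail: Thm 1.7 is
printed on O(𝔸^∞×𝔼^∞): a t-free F may need torus variables or non-algebraic constant terms of the
H_i; the algebraic H_i(z,ϖ₀) must converge and be C¹ on strata of the closed cube at ϖ₀ = 1
(radius); implied by KZ, so only refutable with KZ.) [AyoubRelKZRevisited, Ayoub2015,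
HuberMullerStach2017, KontsevichZagier2001]
#4 VertexLocalLift (crux) — (card LOCAL-KZ rung, unconditional in print) for p_i/q_i ∈ ℚ(z) regular
on a neighbourhood of [0,1]^n there is b₀ such that for b ≥ b₀ every ℤ-relation m₀ + Σ m_i v_i(1/b)
= 0 lifts: w = (ϖ − 1/b)(μ₀ + Σ μ_j v_{G_j}) on [0,1] with Nash G_j (André: the Euler derivatives
E^k(p_i/q_i)) — corollary of Andre1989 Ch. VII Thm 5.2 (quoted verbatim as Papas2022 Thm 2): at ξ =
1/b, K = ℚ, the only place with |ξ|_v < 1 is ∞, so the real relation is global, and non-trivial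
global degree-1 relations have h(ξ) = log b ≤ c₁(Y). NEEDS the named fact (definition request
AndreHassePrincipleGValues) + "v_{p/q} is a G-series with a Fuchsian system" (Lipshitz1989 /
Andre1989 Ch. V). [difficulty: M] (why it might fail: only the Lean match: 1/b must be an ordinary
point inside the real radius of the system of (1, v_i, derivatives); André's triviality is w.r.t.
that enlarged Y (hence the ∃ G_j); deliberately ℚ-rational: for Nash g with irrational germ the
relation need not be global (PellVertexRelation).) [Andre1989, Bombieri1981, Papas2022,
Chudnovsky1984, FischlerRivoal2020, Lipshitz1989]
#9 CubeNashNormalForm (support) — (card PencilNormalForm) every difference of KZ-rational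
representations is KZ-equivalent to a ℤ-combination of cube representations ∫_{[0,1]^{n_i}} g_i with
g_i ℚ-semialgebraic and real-analytic on a neighbourhood of the closed cube (semialgebraic
triangulation + resolution + ramified substitutions u = w^N, all realised by additivity and
change-of-variables moves; null faces are relations by domain additivity). [difficulty: L]
[HuberMullerStach2017, KontsevichZagier2001, BochnakCosteRoy1998]
#9 VertexKernel (support) — the unconditional pay-off — Conjecture 1 in kernel form at the vertex of
the cube: for p_i/q_i ∈ ℚ(z) regular near [0,1]^n there is b₀ such that for b ≥ b₀ every vanishing
ℤ-combination of [1] and the fibres [∫_cube p_i(z/b)/q_i(z/b) dz] (= b^n ∫_{[0,1/b]^n} p_i/q_i by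
one change of variables) lies in KZ.relations. [difficulty: L] [Andre1989, AyoubRelKZRevisited,
KontsevichZagier2001]
#9 VertexGlue (support) — glue of the local programme: VertexLocalLift and DilationTransfer (at ϖ₀ =
1/b, family n_i = n, g_i = p_i/q_i, Nash after shrinking U to an open box) give VertexKernel;
bookkeeping: eval of the combination is w(1/b), integer scalars, Rat casts. [difficulty:
provable-now] [KontsevichZagier2001]
#9 PellVertexRelation (support) — the K ≠ ℚ boundary of lifting, provable now: for the
ℚ-semialgebraic Nash g(z) = (4−3z)/(2√(2−z)) on [0,1], v_g(ϖ) = √(2−ϖ); for Pell solutions t² = 2s²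
− 1 the vertex relation s·v_g(1/s²) − t = 0 holds, is NOT the specialisation of a polynomial
relation among (1, v_g) (so it is non-trivial and non-global in André's sense, of unbounded height),
and yet s·[fibre at 1/s²] − t·[1] ∈ KZ.relations by one Newton–Leibniz move with primitive z√(2 −
z/s²) — the card's (Exc) branch made concrete. [difficulty: provable-now] [Andre1989,
KontsevichZagier2001]

TWO-LAYER PLAN. DilationTransfer ⇐ TFreeAyoub (t-free algebraic form of Thm 1.7 with convergence on
the closed cube) → CubeStokesCalibration (= 0543 generalised
to algebraic H with strata) → DilationTransfer. VertexLocalLift ⇐ DilationIsGSeries (v_{p/q}, E^k: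
G-series + common Fuchsian system) →
AndreAtInverseIntegers (the fact specialised to ξ = 1/b, K = ℚ) → VertexLocalLift. DilationLiftAtOne
⇐ (if it survives refuters) CMTest
(the k² = 1/2 Legendre relation in cube form) → NashLocalLift (single-place, K ≠ ℚ) →
DilationLiftAtOne is NOT a valid glue — children to be
designed only after the CM test is settled.

KILL CRITERIA. ¬DilationLiftAtOne for one explicit Nash family closes the route
`refuted:DilationLiftAtOne` (census: global relations at special fibres are
not functional even after enlargement — lifting is not the global engine; hand the witness to cards
unlikely-intersections /
correspondences-as-multivalued-cov). ¬DilationTransfer (with KZ then false) ⇒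
¬KontsevichZagierPeriods: feeds route Neg with an explicit
functional-but-not-derivable identity. VertexLocalLift failing = mismatch with Andre1989 VII 5.2
hypotheses ⇒ restate (pivot to the exact
printed form), not a kill. VertexKernel proved elsewhere (e.g. by LowDimension-type normal forms for
n = 1) does not moot the route.

NOT DECOMPOSED YET. The single-place (K ≠ ℚ) local lifting for Nash integrands — open in the
literature as far as searched (Chudnovsky's single-place theorem needs
algebraic independence; André's needs globality); the uniform-in-b reading "KZ ⟺ a local–global
principle at the points (1/b, v/b) of the
translation–dilation family" (b-adic subdivision + translations are moves); the (Exc) mechanism at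
special fibres via correspondences; the
E-sector (KZexp) rung, filed informal only; constants b₀ (effective in André: c₁(Y)δ^{3(m−1)}).

CHEAPEST FALSIFIER. Crux 2, smallest instance (n = 1): g₁ = 1/(1+z²) and g₂ = 2z/(1+z⁴) on [0,1]
have the same period π/4 (change of variables z ↦ z², which does
NOT commute with dilation), dilation functions v₁ = arctan(ϖ)/ϖ, v₂ = arctan(ϖ²)/ϖ, so w = v₁ − v₂
vanishes at ϖ = 1 and
u = w/(ϖ−1) = arctan(ϖ(1−ϖ)/(1+ϖ³))/(ϖ(ϖ−1)). Decide whether u is an ℝ_alg[ϖ]-combination of Nash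
dilation functions: D(n=1) = {v : (ϖv)′ Nash}
fails ((ϖu)′ contains an arctan), so the question is whether higher cubes reach it (D(2) ∋ ∫₀¹ F(ϖ,
ϖt)dt for Nash F; all elements of D are
analytic at ϖ = 0 with trivial monodromy there — u is too). A CAS / differential-Galois computation
on this one function settles the smallest
case: u ∉ D kills the crux on day one; an explicit certificate u ∈ D is the template for the CM test
(K = K′ at k² = 1/2 in cube form).
Crux 4: the printed hypotheses of Andre1989 VII Thm 5.2 (Papas2022 p. 7, read) match ξ = 1/b, K = ℚ,
δ = 1 — done, no falsifier left but Lean.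

NUMBERS. André's bound: h(Ш_δ(Y)) ≤ c₁(Y) δ^{3(m−1)}(log δ + 1), strongly non-trivial: c₂(Y) δ^m
(log δ + 1) (Papas2022 Thm 2 = Andre1989 VII Thm 5.2);
here δ = 1, h(1/b) = log b, so b₀ = ⌈exp c₁(Y)⌉. Chudnovsky's single-place radius: |ξ| < exp(−C (log
H)^{4S/(4S+1)}) (FischlerRivoal2020 Thm 1).
Pell family: (s,t) = (1,1), (5,7), (29,41), (169,239), … Items at open: 8 (+1 informal support, +1
definition request after open).

DEFINITION REQUESTS. AndreHassePrincipleGValues (Literature/NumberTheory/Transcendental): `IsGSeries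
(a : ℕ → ℂ)` (Siegel/André: algebraic coefficients, common
denominators d_n ≤ C^n, geometric growth of conjugates, holonomic — cf. the E-side
`Literature.Barriers.Schanuel.IsStrictEFunction`), size,
v-adic evaluation, "non-trivial"/"global" relation of degree δ, and the named fact Andre1989 Ch. VII
Thm 5.2 as printed in Papas2022 Thm 2;
wanted by VertexLocalLift. Optional later: `KZ.dilationValue`, `KZ.IsNashNearCube` abbreviations
(Summits/…/Theorems) to shorten signatures.

Novelty: Searches (2026-08-15; local searchd FTS down, so zbMATH cascade + galaxy + arXiv texts + tree):
zbMATH "linear independence values G-functions" (12: Andre1989, FischlerRivoal2020, Chudnovsky 1985,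
Nagata, Galochkin, Dèbes–Zannier); zbMATH "Papas … G-functions method" (3: Papas2022, Papas 2024,
DawOrr2025); `lit galaxy search "G-functions and geometry" --star all` (20 rows: Fresán–Lam–Qin
arXiv:2502.02147, Papas arXiv:2510.11814, Tretkoff's and Zannier's books); lit read arXiv:1701.09051
pp. 3–4, arXiv:1103.6022 pp. 3–4, 15, arXiv:2201.11240 pp. 7, 19, arXiv:2510.11814 pp. 3, 9, 13; the
six KZ route files; the 123-card index (siblings gauss-manin-rational-certificates,
unlikely-intersections, two-route-hypergeometric-transport,
transcendence-runs-the-calculus-backwards); tree grep (no G-function vocabulary; E-side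
IsStrictEFunction/siegelShidlovskii_algIndep; AyoubRelative Thm 1.7 vendored).
Nearest prior art found: Andre1989 Ch. VII–X with Papas2022 / DawOrr2025 (G-function method on
one-parameter families: local Hasse principle, height bounds at special fibres — never a rules
statement); Papanikolas2007 + AndersonBrownawellPapanikolas2004 + ChangYu2007 (ABP ⇒ function-field
GPC, the imported paradigm); Beukers2006 (E-side lifting theorem); AyoubRelKZRevisited / Ayoub2015
(relative KZ) as used by route AyoubSpecialisation (crux 0362: no engine, no pencil); card
gauss-manin-rational-certificates (families first with D-finite certificates, open core B4
engine-less).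
Delta: the  [refs: 2502.02147, 2510.11814, 1701.09051, 1103.6022, 2201.11240, Andre1989, FischlerRivoal2020, Papas2022, DawOrr2025, Papanikolas2007, AndersonBrownawellPapanikolas2004, ChangYu2007, Beukers2006, Ayoub2015]

Barriers (technique_class: linear-independence-criterion, g-function-hasse-principle): - technique_class: linear-independence-criterion, g-function-hasse-principle
- Literature.Barriers.KontsevichZagierPeriods.kzConjecture_implies_oddZetaAlgIndep: NOT evaded by
crux DilationLiftAtOne (with DilationTransfer + CubeNashNormalForm it implies the summit, hence
odd-zeta independence) — accepted by design: crux 2 is the route's single GPC-strength bet and is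
ranked 2 precisely so refuters attack it first; EVADED by the unconditional rung
(VertexLocalLift/VertexKernel concern only parameters 1/b, b ≥ b₀(family), where Andre1989 VII 5.2
is a theorem; no statement about ζ(odd) at ϖ = 1 follows).
- Literature.Barriers.KontsevichZagierPeriods.kzConjecture_implies_twoPiI_log_algIndep: same status
— hits crux 2 only; the vertex rung at 1/b yields relations among log-type G-values only in Baker's
proven regime (consistent with Literature.NumberTheory.Transcendental.baker), never independence of
2πi and log q.
- Literature.Barriers.KontsevichZagierPeriods.kzConjecture_implies_ellipticPeriods_algIndep: same
status — hits crux 2 only (the CM relation K = K′ at k² = 1/2 is the named test case in its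
why-might-fail); the vertex rung is André's own method, which PRODUCES height bounds at CM fibres
rather than contradicting them.
- Literature.Barriers.KontsevichZagierPeriods.noSemialgebraicPrimitive_inv_sub_two: evaded — the
only primitives the line uses are Ayoub's generators G_i, ALGEBRAIC over ℚ̄(z,ϖ) (Thm 1.7 (a):
∂G/∂z_i − G|₁ + G|₀), hence semialgebraic Newton–Leibniz data; an

History (route lifecycle, newest last):
- 2026-08-15T11:22:47Z · rev 1: dropped stmt-KontsevichZagierPeriods-3641, stmt-KontsevichZagierPeriods-3653, stmt-KontsevichZagierPeriods-3682 — hygiene: remove three accidental informal duplicates (a CLI test 'x', a 'probe', and a re-add) created by this planner minutes after open; the intended E-sector (planner-plancard-KontsevichZagierPeriods-Kont-0fda0c9a-0)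
- 2026-08-16T02:17:47Z · AUTO-CRUX: 2 conjecture-grade item(s) promoted to crux (VertexKernel, ESectorBeukers) — refuter vetting / tiering apply (operator:999:1362873)
- 2026-08-17T18:21:27Z · CLOSED exhausted — exhausted (planner-rbadge-KontsevichZagierPeriods-Lifting-78fa98cf-g3-0)

sub-problem: KontsevichZagierPeriods · status: closed(exhausted) · opened planner-plancard-KontsevichZagierPeriods-Kont-0fda0c9a-0 2026-08-15T11:20:05Z · rev 2 · ledger route-KontsevichZagierPeriods-LiftingCriteria
GENERATED by the gate from the ledger (D-0016/17). Provers cite these decls: `theorem foo : Summit.KontsevichZagierPeriods.KontsevichZagierPeriods.Theses.LiftingCriteria.<Decl> := …` in Summits/KontsevichZagierPeriods/KontsevichZagierPeriods/Theorems/<Name>.lean.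
-/

namespace Summit.KontsevichZagierPeriods.KontsevichZagierPeriods.Theses.LiftingCriteria

open scoped BigOperators Topology Manifold Classical MeasureTheory ProbabilityTheory Matrix InnerProductSpace ComplexConjugate ContinuousMap
open Filter Set Function TopologicalSpace MeasureTheory

attribute [summit_statement] _root_.KontsevichZagierPeriods

open Literature Periods

/-- item stmt-KontsevichZagierPeriods-3571 · crux · rank 2 · closed · moot by None · by planner
why it might fail: GPC-strength and NOT implied by KZ: at a special fibre (CM test: K(k) = K'(k), k² = 1/2, written as cube integrals) the difference quotient w/(ϖ−1) may lie outside the opaque module D (D(n=1) = {v : (ϖv)′ Nash}; closed under products only).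
sources: Beukers2006, AndersonBrownawellPapanikolas2004, Papanikolas2007, Andre1989, Fresan2024
[crux] (card G-Lift, made honest) for Nash cube functions g_i (any dimensions), integers m_i, m₀
with m₀ + Σ m_i ∫_cube g_i = 0, the G-function w(ϖ) = m₀ + Σ m_i v_{g_i}(ϖ) factors as (ϖ −
1)·(μ₀(ϖ) + Σ_j μ_j(ϖ) v_{G_j}(ϖ)) on [0,1] for finitely many further Nash cube functions G_j and
polynomials μ with real-algebraic coefficients — the Beukers/ABP-shaped statement "ev₁ is injective
on D/(ϖ−1)D" for the dilation module D. [difficulty: open-problem] -/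
@[route_item "route-KontsevichZagierPeriods-LiftingCriteria", crux]
def DilationLiftAtOne : Prop :=
  ∀ (S : ℕ) (n : Fin S → ℕ) (g : (i : Fin S) → (Fin (n i) → ℝ) → ℝ) (U : (i : Fin S) → Set (Fin (n i) → ℝ)), (∀ i, IsOpen (U i) ∧ Set.pi Set.univ (fun _ : Fin (n i) => Set.Icc (0:ℝ) 1) ⊆ (U i) ∧ Literature.NumberTheory.Transcendental.IsSemialgebraicFunOn ℚ (U i) (g i) ∧ AnalyticOnNhd ℝ (g i) (U i)) → ∀ (m : Fin S → ℤ) (m₀ : ℤ), (m₀ : ℝ) + ∑ i, (m i : ℝ) * (∫ z in Set.pi Set.univ (fun _ : Fin (n i) => Set.Icc (0:ℝ) 1), g i ((1:ℝ) • z)) = 0 → ∃ (T : ℕ) (d : Fin T → ℕ) (G : (j : Fin T) → (Fin (d j) → ℝ) → ℝ) (V : (j : Fin T) → Set (Fin (d j) → ℝ)) (μ : Fin T → Polynomial ℝ) (μ₀ : Polynomial ℝ), (∀ j, IsOpen (V j) ∧ Set.pi Set.univ (fun _ : Fin (d j) => Set.Icc (0:ℝ) 1) ⊆ (V j) ∧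 Literature.NumberTheory.Transcendental.IsSemialgebraicFunOn ℚ (V j) (G j) ∧ AnalyticOnNhd ℝ (G j) (V j)) ∧ (∀ j k, IsAlgebraic ℚ ((μ j).coeff k)) ∧ (∀ k, IsAlgebraic ℚ (μ₀.coeff k)) ∧ ∀ ϖ ∈ Set.Icc (0:ℝ) 1, (m₀ : ℝ) + ∑ i, (m i : ℝ) * (∫ z in Set.pi Set.univ (fun _ : Fin (n i) => Set.Icc (0:ℝ) 1), g i (ϖ • z)) = (ϖ - 1) * (μ₀.eval ϖ + ∑ j, (μ j).eval ϖ * (∫ z in Set.pi Set.univ (fun _ : Fin (d j) => Set.Icc (0:ℝ) 1), G j (ϖ • z)))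

/-- item stmt-KontsevichZagierPeriods-3572 · crux · rank 3 · closed · moot by None · by planner
why it might fail: Thm 1.7 is printed on O(𝔸^∞×𝔼^∞): a t-free F may need torus variables or non-algebraic constant terms of the H_i; the algebraic H_i(z,ϖ₀) must converge and be C¹ on strata of the closed cube at ϖ₀ = 1 (radius); implied by KZ, so only refutable with KZ.
sources: AyoubRelKZRevisited, Ayoub2015, HuberMullerStach2017, KontsevichZagier2001
[crux] (card Geo→Moves / RelativeTransfer, engine named) a functional relation w = (ϖ − ϖ₀)(μ₀ + Σ
μ_j v_{G_j}) on [0,1] among Nash dilation functions, specialised at a rational ϖ₀ ∈ (0,1], is a KZ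
relation: m₀·[1] + Σ m_i·[∫_cube g_i(ϖ₀ z)dz] ∈ KZ.relations. Engine: the integrand F(z,ϖ) = m₀ + Σ
m_i g_i(ϖz) − (ϖ−ϖ₀)(…) lies in Ayoub's t-free O†_alg with ∫F = 0, so Thm 1.7 writes F = Σ
relA_i(H_i) with H_i ALGEBRAIC; specialise at ϖ₀ and use the cube calibration (AyoubSpecialisation
item 0543,
Summit.KontsevichZagierPeriods.KontsevichZagierPeriods.Theses.AyoubSpecialisation.AyoubRelACubeCalibration)
— algebraic primitives are legal Newton–Leibniz data. [difficulty: L] -/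
@[route_item "route-KontsevichZagierPeriods-LiftingCriteria", crux]
def DilationTransfer : Prop :=
  ∀ (S : ℕ) (n : Fin S → ℕ) (g : (i : Fin S) → (Fin (n i) → ℝ) → ℝ) (U : (i : Fin S) → Set (Fin (n i) → ℝ)), (∀ i, IsOpen (U i) ∧ Set.pi Set.univ (fun _ : Fin (n i) => Set.Icc (0:ℝ) 1) ⊆ (U i) ∧ Literature.NumberTheory.Transcendental.IsSemialgebraicFunOn ℚ (U i) (g i) ∧ AnalyticOnNhd ℝ (g i) (U i)) → ∀ (m : Fin S → ℤ) (m₀ : ℤ) (ϖ₀ : ℚ), 0 < ϖ₀ → ϖ₀ ≤ 1 → (∃ (T : ℕ) (d : Fin T → ℕ) (G : (j : Fin T) → (Fin (d j) → ℝ) → ℝ) (V : (j : Fin T) → Set (Fin (d j) → ℝ)) (μ : Fin T → Polynomial ℝ) (μ₀ : Polynomial ℝ), (∀ j, IsOpen (V j) ∧ Set.pi Set.univ (fun _ : Fin (d j) => Set.Icc (0:ℝ) 1) ⊆ (V j) ∧ Literature.NumberTheory.Transcendental.IsSemialgebraicFunOn ℚ (V j) (G j) ∧ AnalyticOnNhd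 ℝ (G j) (V j)) ∧ (∀ j k, IsAlgebraic ℚ ((μ j).coeff k)) ∧ (∀ k, IsAlgebraic ℚ (μ₀.coeff k)) ∧ ∀ ϖ ∈ Set.Icc (0:ℝ) 1, (m₀ : ℝ) + ∑ i, (m i : ℝ) * (∫ z in Set.pi Set.univ (fun _ : Fin (n i) => Set.Icc (0:ℝ) 1), g i (ϖ • z)) = (ϖ - (ϖ₀ : ℝ)) * (μ₀.eval ϖ + ∑ j, (μ j).eval ϖ * (∫ z in Set.pi Set.univ (fun _ : Fin (d j) => Set.Icc (0:ℝ) 1), G j (ϖ • z)))) → ∀ (r : (i : Fin S) → Literature.NumberTheory.Transcendental.KZ.IntegralRep (n i)) (u : Literature.NumberTheory.Transcendental.KZ.IntegralRep 0), (∀ i, (r i).domain = Set.pi Set.univ (fun _ : Fin (n i) => Set.Icc (0:ℝ) 1) ∧ ∀ z ∈ Set.pi Set.univ (fun _ : Fin (n i) => Set.Icc (0:ℝ) 1), (r i).integrand z = g i ((ϖ₀ : ℝ) • z)) → u.domain = Set.univ → (∀ x, u.integrand x = 1) → m₀ • Literature.NumberTheory.Transcendental.KZ.of u + ∑ i, m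 i • Literature.NumberTheory.Transcendental.KZ.of (r i) ∈ Literature.NumberTheory.Transcendental.KZ.relations

/-- item stmt-KontsevichZagierPeriods-3573 · crux · rank 4 · closed · moot by None · by planner
why it might fail: only the Lean match: 1/b must be an ordinary point inside the real radius of the system of (1, v_i, derivatives); André's triviality is w.r.t. that enlarged Y (hence the ∃ G_j); deliberately ℚ-rational: for Nash g with irrational germ the relation need not be global (PellVertexRelation).
sources: Andre1989, Bombieri1981, Papas2022, Chudnovsky1984, FischlerRivoal2020, Lipshitz1989
[crux] (card LOCAL-KZ rung, unconditional in print) for p_i/q_i ∈ ℚ(z) regular on a neighbourhood of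
[0,1]^n there is b₀ such that for b ≥ b₀ every ℤ-relation m₀ + Σ m_i v_i(1/b) = 0 lifts: w = (ϖ −
1/b)(μ₀ + Σ μ_j v_{G_j}) on [0,1] with Nash G_j (André: the Euler derivatives E^k(p_i/q_i)) —
corollary of Andre1989 Ch. VII Thm 5.2 (quoted verbatim as Papas2022 Thm 2): at ξ = 1/b, K = ℚ, the
only place with |ξ|_v < 1 is ∞, so the real relation is global, and non-trivial global degree-1
relations have h(ξ) = log b ≤ c₁(Y). NEEDS the named fact (definition request
AndreHassePrincipleGValues) + "v_{p/q} is a G-series with a Fuchsian system" (Lipshitz1989 /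
Andre1989 Ch. V). [difficulty: M] -/
@[route_item "route-KontsevichZagierPeriods-LiftingCriteria"]
def VertexLocalLift : Prop :=
  ∀ (nn S : ℕ) (p q : Fin S → MvPolynomial (Fin nn) ℚ) (U : Set (Fin nn → ℝ)), IsOpen U → Set.pi Set.univ (fun _ : Fin nn => Set.Icc (0:ℝ) 1) ⊆ U → (∀ i, ∀ z ∈ U, MvPolynomial.aeval z (q i) ≠ 0) → ∃ b₀ : ℕ, ∀ b : ℕ, b₀ ≤ b → ∀ (m : Fin S → ℤ) (m₀ : ℤ), (m₀ : ℝ) + ∑ i, (m i : ℝ) * (∫ z in Set.pi Set.univ (fun _ : Fin nn => Set.Icc (0:ℝ) 1), (fun z => MvPolynomial.aeval z (p i) / MvPolynomial.aeval z (q i)) (((b : ℝ)⁻¹) • z)) = 0 → ∃ (T : ℕ) (d : Fin T → ℕ) (G : (j : Fin T) → (Fin (d j) → ℝ) → ℝ) (V : (j : Fin T) → Set (Fin (d j) → ℝ)) (μ : Fin T → Polynomial ℝ) (μ₀ : Polynomial ℝ), (∀ j, IsOpen (V j) ∧ Set.pi Set.univ (fun _ : Fin (d j) => Set.Icc (0:ℝ)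 1) ⊆ (V j) ∧ Literature.NumberTheory.Transcendental.IsSemialgebraicFunOn ℚ (V j) (G j) ∧ AnalyticOnNhd ℝ (G j) (V j)) ∧ (∀ j k, IsAlgebraic ℚ ((μ j).coeff k)) ∧ (∀ k, IsAlgebraic ℚ (μ₀.coeff k)) ∧ ∀ ϖ ∈ Set.Icc (0:ℝ) 1, (m₀ : ℝ) + ∑ i, (m i : ℝ) * (∫ z in Set.pi Set.univ (fun _ : Fin nn => Set.Icc (0:ℝ) 1), (fun z => MvPolynomial.aeval z (p i) / MvPolynomial.aeval z (q i)) (ϖ • z)) = (ϖ - ((b : ℝ)⁻¹)) * (μ₀.eval ϖ + ∑ j, (μ j).eval ϖ * (∫ z in Set.pi Set.univ (fun _ : Fin (d j) => Set.Icc (0:ℝ) 1), G j (ϖ • z)))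

/-- item stmt-KontsevichZagierPeriods-3575 · crux (kind.auto-crux: conjecture-grade) · rank 9 · closed · moot by None · by planner
why it might fail: auto-crux — conjecture-grade statement (docstring avows it ('Conjecture')); it is open, so it may simply be false
sources: Andre1989, AyoubRelKZRevisited, KontsevichZagier2001
[support] the unconditional pay-off — Conjecture 1 in kernel form at the vertex of the cube: for
p_i/q_i ∈ ℚ(z) regular near [0,1]^n there is b₀ such that for b ≥ b₀ every vanishing ℤ-combination
of [1] and the fibres [∫_cube p_i(z/b)/q_i(z/b) dz] (= b^n ∫_{[0,1/b]^n} p_i/q_i by one change of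
variables) lies in KZ.relations. [difficulty: L] -/
@[route_item "route-KontsevichZagierPeriods-LiftingCriteria"]
def VertexKernel : Prop :=
  ∀ (nn S : ℕ) (p q : Fin S → MvPolynomial (Fin nn) ℚ) (U : Set (Fin nn → ℝ)), IsOpen U → Set.pi Set.univ (fun _ : Fin nn => Set.Icc (0:ℝ) 1) ⊆ U → (∀ i, ∀ z ∈ U, MvPolynomial.aeval z (q i) ≠ 0) → ∃ b₀ : ℕ, ∀ b : ℕ, b₀ ≤ b → ∀ (m : Fin S → ℤ) (m₀ : ℤ), ∀ (r : Fin S → Literature.NumberTheory.Transcendental.KZ.IntegralRep nn) (u : Literature.NumberTheory.Transcendental.KZ.IntegralRep 0), (∀ i, (r i).domain = Set.pi Set.univ (fun _ : Fin nn => Set.Icc (0:ℝ) 1) ∧ ∀ z ∈ Set.pi Set.univ (fun _ : Fin nn => Set.Icc (0:ℝ) 1), (r i).integrand z = MvPolynomial.aeval (((b : ℝ)⁻¹) • z) (p i) / MvPolynomial.aeval (((b : ℝ)⁻¹) • z) (q i)) → u.domain = Set.univ → (∀ x, u.integrand x = 1) → Literature.NumberTheory.Transcendental.KZ.eval (m₀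 • Literature.NumberTheory.Transcendental.KZ.of u + ∑ i, m i • Literature.NumberTheory.Transcendental.KZ.of (r i)) = 0 → m₀ • Literature.NumberTheory.Transcendental.KZ.of u + ∑ i, m i • Literature.NumberTheory.Transcendental.KZ.of (r i) ∈ Literature.NumberTheory.Transcendental.KZ.relations

/-- item stmt-KontsevichZagierPeriods-3626 · crux (kind.auto-crux: conjecture-grade) · rank 9 · closed · moot by None · by planner
why it might fail: auto-crux — conjecture-grade statement (docstring avows it ('Conjecture')); it is open, so it may simply be false
sources: conjecture-registry
[support] (card E-sector rung; informal on purpose, off-summit) The exponential dilation module: for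
a rational polytope P ⊂ ℝ^n and f, h ∈ ℚ[z], ϖ ↦ ∫_P e^{−ϖ f(z)} h(z) dz = Σ_k (−ϖ)^k/k! ∫_P f^k h
is an E-function over ℚ (the moments ∫_P f^k h are rationals with geometric denominators), its value
at ϖ = 1 is an exponential period in the sense of Literature.NumberTheory.Transcendental.KZexp
(KZExpCalculus.lean), and ϖ = 1 is a non-singular point of its differential system (singularities
only at 0, ∞). Beukers2006 (refined Siegel–Shidlovskii, Thm 1.3/Cor 1.4; tree has only the
algebraic-independence form Literature.Barriers.Schanuel.siegelShidlovskii_algIndep) therefore makes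
the analogue of DilationLiftAtOne a THEOREM for this module: every ℚ̄-linear relation among such
values at ϖ = 1 is the specialisation of a ℚ̄[ϖ]-linear relation among the functions. CLAIM to be
typed later (needs an exponential analogue of Ayoub revisited Thm 1.7, not in print, and
Fresán–Jossen FresanJossen2020 for 'E-functions of this shape are exponential period functions'):
with an exponential DilationTransfer, every vanishing ℤ-combination of KZexp representations ∫_P
e^{−f} h (P rational polytope, f, h -/
@[route_item "route-KontsevichZagierPeriods-LiftingCriteria"]
def ESectorBeukers : Prop :=
  (∀ (n N : ℕ) (v : Fin N → Fin n → ℚ) (f h : MvPolynomial (Fin n) ℚ), (Literature.Barriers.Schanuel.IsStrictEFunction (fun k : ℕ => (((-1 : ℝ) ^ k * ∫ z in convexHull ℝ (Set.range fun s l => (v s l : ℝ)), (MvPolynomial.aeval z f) ^ k * MvPolynomial.aeval z h : ℝ) : ℂ)) ∧ (∀ k : ℕ, ∃ q : ℚ, (∫ z in convexHull ℝ (Set.range fun s l => (v s l : ℝ)), (MvPolynomial.aeval z f) ^ k * MvPolynomial.aeval z h) = (q : ℝ)) ∧ (∀ ϖ : ℝ, Literature.Barriers.Schanuel.eSeries (fun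 k : ℕ => (((-1 : ℝ) ^ k * ∫ z in convexHull ℝ (Set.range fun s l => (v s l : ℝ)), (MvPolynomial.aeval z f) ^ k * MvPolynomial.aeval z h : ℝ) : ℂ)) (ϖ : ℂ) = ((∫ z in convexHull ℝ (Set.range fun s l => (v s l : ℝ)), Real.exp (-(ϖ * MvPolynomial.aeval z f)) * MvPolynomial.aeval z h : ℝ) : ℂ))) ∧ (∃ r : Literature.NumberTheory.Transcendental.KZexp.IntegralRep n, r.value = ∫ z in convexHull ℝ (Set.range fun s l => (v s l : ℝ)), Real.exp (-((1 : ℝ) * MvPolynomial.aeval z f)) * MvPolynomial.aeval z h) ∧ (∃ (T : ℕ) (d : Fin T → ℕ) (M : Fin T → ℕ) (w : (j : Fin T) → Fin (M j) → Fin (d j) → ℚ) (p q : (j : Fin T) → MvPolynomial (Fin (d j)) ℚ) (a : Polynomial ℚ) (b c : Fin T → Polynomial ℚ) (A : Fin T → Fin T → Polynomial ℚ) (e : ℕ), (∀ ϖ : ℝ, ϖ ^ e * deriv (fun ϖ' : ℝ => ∫ z in convexHull ℝ (Set.range fun s l => (v s l : ℝ)), Real.exp (-(ϖ' * MvPolynomial.aeval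 z f)) * MvPolynomial.aeval z h) ϖ = Polynomial.aeval ϖ a * (∫ z in convexHull ℝ (Set.range fun s l => (v s l : ℝ)), Real.exp (-(ϖ * MvPolynomial.aeval z f)) * MvPolynomial.aeval z h) + ∑ j, Polynomial.aeval ϖ (b j) * (∫ z in convexHull ℝ (Set.range fun s l => (w j s l : ℝ)), Real.exp (-(ϖ * MvPolynomial.aeval z (p j))) * MvPolynomial.aeval z (q j))) ∧ (∀ (j : Fin T) (ϖ : ℝ), ϖ ^ e * deriv (fun ϖ' : ℝ => ∫ z in convexHull ℝ (Set.range fun s l => (w j s l : ℝ)), Real.exp (-(ϖ' * MvPolynomial.aeval z (p j))) * MvPolynomial.aeval z (q j)) ϖ = Polynomial.aeval ϖ (c j) * (∫ z in convexHull ℝ (Set.range fun s l => (v s l : ℝ)), Real.exp (-(ϖ * MvPolynomial.aeval z f)) * MvPolynomial.aeval z h) + ∑ j', Polynomial.aeval ϖ (A j j') * (∫ z in convexHull ℝ (Set.range fun s l => (w j' s l : ℝ)), Real.exp (-(ϖ * MvPolynomial.aeval z (p j'))) * MvPolynomial.aeval z (q j'))))) ∧ (∀ (S : ℕ) (n : Fin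 S → ℕ) (N : Fin S → ℕ) (v : (i : Fin S) → Fin (N i) → Fin (n i) → ℚ) (f h : (i : Fin S) → MvPolynomial (Fin (n i)) ℚ) (m : Fin S → ℤ), ∑ i, (m i : ℝ) * (∫ z in convexHull ℝ (Set.range fun s l => (v i s l : ℝ)), Real.exp (-((1 : ℝ) * MvPolynomial.aeval z (f i))) * MvPolynomial.aeval z (h i)) = 0 → ∃ (T : ℕ) (d : Fin T → ℕ) (M : Fin T → ℕ) (w : (j : Fin T) → Fin (M j) → Fin (d j) → ℚ) (p q : (j : Fin T) → MvPolynomial (Fin (d j)) ℚ) (μ : Fin T → Polynomial ℝ), (∀ j k, IsAlgebraic ℚ ((μ j).coeff k)) ∧ ∀ ϖ : ℝ, ∑ i, (m i : ℝ) * (∫ z in convexHull ℝ (Set.range fun s l => (v i s l : ℝ)), Real.exp (-(ϖ * MvPolynomial.aeval z (f i))) * MvPolynomial.aeval z (h i)) = (ϖ - 1) * ∑ j, (μ j).eval ϖ * (∫ z in convexHull ℝ (Set.range fun s l => (w j s l : ℝ)), Real.exp (-(ϖ * MvPolynomial.aeval z (p j))) * MvPolynomial.aeval z (q j)))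

/-- item stmt-KontsevichZagierPeriods-3574 · support · rank 9 · closed · proved by Summit.KontsevichZagierPeriods.SymplecticScissors.CubeNashNormalForm.cubeNashNormalForm_symplecticScissors_proof @ d70c8da77019 (prover) · by planner
sources: HuberMullerStach2017, KontsevichZagier2001, BochnakCosteRoy1998
[support] (card PencilNormalForm) every difference of KZ-rational representations is KZ-equivalent
to a ℤ-combination of cube representations ∫_{[0,1]^{n_i}} g_i with g_i ℚ-semialgebraic and
real-analytic on a neighbourhood of the closed cube (semialgebraic triangulation + resolution +
ramified substitutions u = w^N, all realised by additivity and change-of-variables moves; null faces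
are relations by domain additivity). [difficulty: L] -/
@[route_item "route-KontsevichZagierPeriods-LiftingCriteria", crux]
def CubeNashNormalForm : Prop :=
  ∀ (k k' : ℕ) (r : Literature.NumberTheory.Transcendental.KZ.IntegralRep k) (r' : Literature.NumberTheory.Transcendental.KZ.IntegralRep k'), r.IsRational → r'.IsRational → ∃ (S : ℕ) (n : Fin S → ℕ) (g : (i : Fin S) → (Fin (n i) → ℝ) → ℝ) (U : (i : Fin S) → Set (Fin (n i) → ℝ)) (ε : Fin S → ℤ) (s : (i : Fin S) → Literature.NumberTheory.Transcendental.KZ.IntegralRep (n i)), (∀ i, IsOpen (U i) ∧ Set.pi Set.univ (fun _ : Fin (n i) => Set.Icc (0:ℝ) 1) ⊆ (U i) ∧ Literature.NumberTheory.Transcendental.IsSemialgebraicFunOn ℚ (U i) (g i) ∧ AnalyticOnNhd ℝ (g i) (U i)) ∧ (∀ i, (s i).domain = Set.pi Set.univ (fun _ : Fin (n i) => Set.Icc (0:ℝ) 1) ∧ ∀ z ∈ Set.pi Set.univ (fun _ : Fin (n i) => Set.Icc (0:ℝ) 1), (s i).integrand z = g i z) ∧ Literature.NumberTheory.Transcendental.KZ.of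 r - Literature.NumberTheory.Transcendental.KZ.of r' - ∑ i, ε i • Literature.NumberTheory.Transcendental.KZ.of (s i) ∈ Literature.NumberTheory.Transcendental.KZ.relations

/-- item stmt-KontsevichZagierPeriods-3576 · support · rank 9 · closed · proved by Summit.KontsevichZagierPeriods.LiftingCriteria.vertexGlue_proof @ d4edf071e019 (prover) · by planner
sources: KontsevichZagier2001
[support] glue of the local programme: VertexLocalLift and DilationTransfer (at ϖ₀ = 1/b, family n_i
= n, g_i = p_i/q_i, Nash after shrinking U to an open box) give VertexKernel; bookkeeping: eval of
the combination is w(1/b), integer scalars, Rat casts. [difficulty: provable-now] -/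
@[route_item "route-KontsevichZagierPeriods-LiftingCriteria"]
def VertexGlue : Prop :=
  VertexLocalLift → DilationTransfer → VertexKernel

/-- item stmt-KontsevichZagierPeriods-3577 · support · rank 9 · closed · proved by Summit.KontsevichZagierPeriods.LiftingCriteria.pellVertexRelation_proof @ ba3d26648a63 (prover) · by planner
sources: Andre1989, KontsevichZagier2001
[support] the K ≠ ℚ boundary of lifting, provable now: for the ℚ-semialgebraic Nash g(z) =
(4−3z)/(2√(2−z)) on [0,1], v_g(ϖ) = √(2−ϖ); for Pell solutions t² = 2s² − 1 the vertex relation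
s·v_g(1/s²) − t = 0 holds, is NOT the specialisation of a polynomial relation among (1, v_g) (so it
is non-trivial and non-global in André's sense, of unbounded height), and yet s·[fibre at 1/s²] −
t·[1] ∈ KZ.relations by one Newton–Leibniz move with primitive z√(2 − z/s²) — the card's (Exc)
branch made concrete. [difficulty: provable-now] -/
@[route_item "route-KontsevichZagierPeriods-LiftingCriteria"]
def PellVertexRelation : Prop :=
  (∀ ϖ ∈ Set.Ioc (0:ℝ) 1, (∫ z in Set.pi Set.univ (fun _ : Fin 1 => Set.Icc (0:ℝ) 1), (fun z : Fin 1 → ℝ => (4 - 3 * z 0) / (2 * Real.sqrt (2 - z 0))) (ϖ • z)) = Real.sqrt (2 - ϖ)) ∧ (∀ (s t : ℕ), 0 < s → (t : ℤ) ^ 2 = 2 * (s : ℤ) ^ 2 - 1 → (¬ ∃ (l₁ l₀ : Polynomial ℝ), l₁.eval (((s : ℝ) ^ 2)⁻¹) = s ∧ l₀.eval (((s : ℝ) ^ 2)⁻¹) = -(t : ℝ) ∧ ∀ ϖ ∈ Set.Icc (0:ℝ) 1, l₁.eval ϖ * Real.sqrt (2 - ϖ) + l₀.eval ϖ = 0)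 ∧ ∀ (r : Literature.NumberTheory.Transcendental.KZ.IntegralRep 1) (u : Literature.NumberTheory.Transcendental.KZ.IntegralRep 0), r.domain = Set.pi Set.univ (fun _ : Fin 1 => Set.Icc (0:ℝ) 1) → (∀ z ∈ Set.pi Set.univ (fun _ : Fin 1 => Set.Icc (0:ℝ) 1), r.integrand z = (fun z : Fin 1 → ℝ => (4 - 3 * z 0) / (2 * Real.sqrt (2 - z 0))) ((((s : ℝ) ^ 2)⁻¹) • z)) → u.domain = Set.univ → (∀ x, u.integrand x = 1) → (s : ℤ) • Literature.NumberTheory.Transcendental.KZ.of r - (t : ℤ) • Literature.NumberTheory.Transcendental.KZ.of u ∈ Literature.NumberTheory.Transcendental.KZ.relations)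

/-- item stmt-KontsevichZagierPeriods-3578 · assembly · rank 1 · closed · proved by Summit.KontsevichZagierPeriods.LiftingCriteria.assembly_proof (prover) · by planner
sources: KontsevichZagier2001, HuberMullerStach2017
[assembly] CubeNashNormalForm → DilationTransfer → DilationLiftAtOne → KontsevichZagierPeriods. -/
@[route_item "route-KontsevichZagierPeriods-LiftingCriteria"]
def Assembly : Prop :=
  CubeNashNormalForm → DilationTransfer → DilationLiftAtOne → KontsevichZagierPeriods

/-! D-0027 §2.1 — DECIDING THEOREM (planner-authored via `route open/edit --closes-file`; by planner-rbadge-KontsevichZagierPeriods-Lifting-78fa98cf-g2-0 2026-08-15T16:14:31Z) — ARCHIVED: route closed (exhausted) 2026-08-17T18:21:27Z; kept so importers keep building: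
its hypotheses are this route's items and its conclusion the sub-problem Statement (glue_lint), and it elaborates with this file. -/

@[closes "route-KontsevichZagierPeriods-LiftingCriteria"] theorem closes (hN : CubeNashNormalForm) (hT : DilationTransfer) (hL : DilationLiftAtOne) :
    KontsevichZagierPeriods := by
  intro k k' r r' hr hr' hval
  -- (1) cube-Nash normal form of [r] − [r'] (CubeNashNormalForm)
  obtain ⟨S, n, g, U, ε, s, hg, hs, hrel⟩ := hN k k' r r' hr hr'
  have hcube : ∀ i, MeasurableSet (Set.pi Set.univ (fun _ : Fin (n i) => Set.Icc (0:ℝ) 1)) :=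
    fun i => MeasurableSet.univ_pi (fun _ => measurableSet_Icc)
  -- the dilation value at ϖ = 1 of g i is the value of the cube representation s i
  have hsval : ∀ i, (∫ z in Set.pi Set.univ (fun _ : Fin (n i) => Set.Icc (0:ℝ) 1), g i ((1:ℝ) • z))
      = (s i).value := by
    intro i
    simp only [one_smul]
    rw [Literature.NumberTheory.Transcendental.KZ.IntegralRep.value, (hs i).1]
    exact (MeasureTheory.setIntegral_congr_fun (hcube i) (hs i).2).symm
  -- (2) soundness of the KZ calculus (relations_le_ker_eval_holds, proved Literature):
  --     the normal-form combination evaluates to 0 and value r = value r', hence Σ ε_i v_{g_i}(1) = 0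
  have hker := Literature.NumberTheory.Transcendental.KZ.relations_le_ker_eval_holds hrel
  simp only [AddMonoidHom.mem_ker, map_sub, map_sum, map_zsmul,
    Literature.NumberTheory.Transcendental.KZ.eval_of, zsmul_eq_mul, hval, sub_self, zero_sub,
    neg_eq_zero] at hker
  have hsum : ((0:ℤ) : ℝ) + ∑ i, (ε i : ℝ) *
      (∫ z in Set.pi Set.univ (fun _ : Fin (n i) => Set.Icc (0:ℝ) 1), g i ((1:ℝ) • z)) = 0 := by
    simp only [hsval, Int.cast_zero, zero_add]
    exact hker
  -- (3) lift the numerical relation at ϖ = 1 to a functional one (DilationLiftAtOne, m = ε, m₀ = 0)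
  obtain ⟨T, d, G, V, μ, μ₀, hG, hμ, hμ₀, hfun⟩ := hL S n g U hg ε 0 hsum
  -- the unit representation [pt, 1] in dimension 0
  obtain ⟨u, hu1, hu2⟩ : ∃ u : Literature.NumberTheory.Transcendental.KZ.IntegralRep 0,
      u.domain = Set.univ ∧ ∀ x, u.integrand x = 1 := by
    have hvol : MeasureTheory.volume (Set.univ : Set (Fin 0 → ℝ)) = 1 := by
      rw [MeasureTheory.volume_pi, MeasureTheory.Measure.pi_univ]; simp
    exact ⟨{ domain := Set.univ
             integrand := fun _ => 1
             isSemialgebraic_domain := Literature.ModelTheory.ExponentialFields.isSemialgebraic_univ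
             isSemialgebraicFunOn_integrand := by
               simpa using Literature.NumberTheory.Transcendental.isSemialgebraicFunOn_aeval
                 (Literature.ModelTheory.ExponentialFields.isSemialgebraic_univ
                   (k := ℚ) (ι := Fin 0) (R := ℝ)) (1 : MvPolynomial (Fin 0) ℚ)
             integrableOn := MeasureTheory.integrableOn_const (hs := by simp [hvol]) },
           rfl, fun _ => rfl⟩
  -- (4) transfer the functional relation, specialised at ϖ₀ = 1, into the KZ calculus
  --     (DilationTransfer with reps s i and the unit rep u): 0 • [u] + Σ ε_i [s_i] ∈ relations
  have hmem := hT S n g U hg ε 0 1 one_pos le_rfl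
    ⟨T, d, G, V, μ, μ₀, hG, hμ, hμ₀, fun ϖ hϖ => by rw [Rat.cast_one]; exact hfun ϖ hϖ⟩
    s u (fun i => ⟨(hs i).1, fun z hz => by rw [Rat.cast_one, one_smul]; exact (hs i).2 z hz⟩)
    hu1 hu2
  simp only [zero_smul, zero_add] at hmem
  -- (5) [r] − [r'] = ([r] − [r'] − Σ ε_i [s_i]) + Σ ε_i [s_i] ∈ relations, i.e. KZ.Equivalent r r'
  have h := add_mem hrel hmem
  rw [sub_add_cancel] at h
  exact h

end Summit.KontsevichZagierPeriods.KontsevichZagierPeriods.Theses.LiftingCriteria
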